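import Literature.NumberTheory.Automorphic.Liu2021.LemD1Item1NonsplitLetterOfAnisotropic
import Literature.NumberTheory.Automorphic.Liu2021.LemD1IsotropyOfPlace
import Literature.NumberTheory.GelbartRogawski1991.LocalKudlaSplittingRigidity
import HarnessLib

/-!
# [Liu2021, Lem. D.1, first sentence + (1)] AS PRINTED at an ANISOTROPIC non-split place FROM THE PINNED CENTRE DICHOTOMY, and the
# booked letters ★ `LemD1_1AsPrintedNonsplitCM₂` ∕ ★ `LemD1_1AsPrintedCM₂` from it — PROVED junction (theorems only)

Topic `NumberTheory/Automorphic/Liu2021`; namespaces `Literature.NumberTheory.Automorphic.Liu2021.LemD1OfPlace` (§0),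
`Literature.NumberTheory.Automorphic.Liu2021.Def411WeilCarriers` (§1–§2), `Literature.NumberTheory.Automorphic.Liu2021.LemD1RankTwoCMLetters` (§3) —
those of ★ `LemD1DataOfPlace.lean`, ★ `LemD1Item1AtV2OfIsotropic.lean` (B-p04 (g43), p849478), ★ `LemD1Item1NonsplitLetterOfAnisotropic.lean` (p849507),
whose road this file continues at the anisotropic non-split places.  KERNEL: theorems only (no definition, no named fact, no `sorry`, no
instance, no notation).  Cell hodgecm-mathlib, floor 0, half-A line LD1 (seat LD1-p02 (g3)); `--supports stmt-HodgeConjecture-24832`.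

WHY.  After ★ p849478 (isotropic non-split places) and ★ p849507 (reduction), the booked letter ★ `LemD1RankTwoCMLetters.LemD1_1AsPrintedNonsplitCM₂`
([Liu2021, Lem. D.1, first sentence + (1)] on the rank-2 CM θ-package `(λ′, a′, χ)` at the non-split places) is OPEN ONLY at the finitely many non-split
places `v` of `L⁺` where the plane `(L_v², diag dV)` is ANISOTROPIC.  There the first sentence is ★ (`isIrreducibleOrZero_and_isAdmissible_localLemD1DataAtV₂_of_isField`,
[MVW, IV.4]) and item (1) reads «`ω(μ_v, ε_v, χ_v) = 0 ⟺ χ̌_v = μ_v²`».  The structural half of that equivalence is ★ p849778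
`MoeglinVignerasWaldspurger1987.rankOne_theta_anisotropicPlane_dichotomy` (B-p04 (g43)): at an anisotropic plane EXACTLY ONE unitary continuous character
`χ₀` of the centre `E_v¹` has vanishing `χ₀`-coinvariants — for ANY smooth section; what print adds is the PIN `χ̌₀ = μ_v²` for Liu's splitting `ι_μ`
([HarrisKudlaSweet1996, Prop. 5.1 (iii)], Liu's proof l. 5245).  This file is the JUNCTION: from the PINNED dichotomy at `v`, in the coinvariant currency
of the θ-package's local Weil factor `ω_v = 𝓢.omegaLoc v` along the local centre (the currency of ★ `quotEquivLocalType₂` and of ★ p849478 §2),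

  (hR) «∃ χ₀ : U(⟨a⟩)(F_v) →* ℂˣ (open kernel), ∀ χ′ unitary continuous, Coinv_{χ′}(ω_v ∘ (z ↦ z·1)) ≠ 0 ↔ χ′ ≠ χ₀»  — ★ p849778's shape,
  (hP) «∃ χ′ : U(⟨a⟩)(F_v) →* ℂˣ, (∀ x ∈ E_vˣ, χ′(θ(x/x̄)) = μ_v(x)²) ∧ Coinv_{χ′}(ω_v ∘ (z ↦ z·1)) = 0»  — the printed pin, vanishing direction
       (SOME pinned character vanishes; all pinned characters coincide by Hilbert 90, §0),

to the letter's body `LemD1_1AsPrinted (localLemD1DataAtV₂ … v)` (§1 generic `N = 2`, §2 the CM reading at one place), and from its `∀ v` form to the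
letters themselves (§3, through ★ `lemD1_1AsPrintedNonsplitCM₂_of_forall_isAnisotropic` ∕ `toAllPlaces`).  So the two booked rows L1ns ∕ L1 close BY NAME
the moment the pinned dichotomy is proved for the CM section `𝓢_{λ′,a′}.s v` at the anisotropic non-split `v` (= (R) the CM reading of ★ p849778 +
(P) the pin; B-p04 (g43) road memo `F0/P6/B-p04/g43/MEMO-L1ns-road.v1.B-p04g43.md` §3).

* §0 `LemD1OfPlace.exists_theta_divConj_eq` — HILBERT 90 read on the centre: at a non-split place every `u ∈ U(J₁)(F_v)` is `θ(x/x̄)` for a unit `x` of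
  `E_v` (★ `theta_surjective` + ★ `exists_unit_mul_conj_eq`); hence two characters of `U(J₁)(F_v)` agreeing on all `θ(x/x̄)` are equal
  (`eq_of_forall_apply_theta_divConj_eq`).
* §0b `LemD1OfPlace.exists_centreChar_apply_theta_divConj_eq_mu_sq` — THE `μ_v²`-CHARACTER OF THE CENTRE EXISTS, unitary and continuous: it is `μ_v` read on
  `E_v¹` through `u ↦ det u` — the kernel clause of Step 2 gives `μ_v(x x̄) = 1`, so `μ_v(x)² = μ_v(x/x̄)`; i.e. «`χ̌ = μ²`» ⟺ «`χ = μ|_{E¹}`».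
* readings `chi_∕S_∕mu_localLemD1DataAtV₂`, `check_chi_localLemD1DataAtV₂_apply` (`χ̌_v(x) = χ_v(θ(x/x̄))` on the datum; `rfl`).
* §1 `Def411WeilCarriers.lemD1_1AsPrinted_localLemD1DataAtV₂_of_isField_of_isAnisotropic_of_pinnedDichotomy` — `E_v` a field, `N = 2`, the datum
  anisotropic, (hR), (hP) ⇒ `LemD1_1AsPrinted (localLemD1DataAtV₂ … v)`: first sentence ★; item (1) «⇒»: `ω = 0` makes the datum's `χ_v` the vanishing
  character `χ₀` (hR), and `χ₀` is pinned because the `μ_v²`-character of §0b vanishes (hP) and is unitary continuous (hR's uniqueness); «⇐»: `χ̌_v = μ_v²`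
  is the pin for `χ_v` itself, so (hP) kills its coinvariants — both through ★ `quotEquivLocalType₂` (`ω(μ_v, ε_v, χ_v) ≅ Coinv_{χ_v}`).
* §2 `…_cm_of_forall_smul_eq_of_isAnisotropic_of_pinnedDichotomy` — the READING on the rank-2 CM θ-package `(λ′, a′, χ)` at ONE non-split anisotropic place
  (binders = the letter's + guard `hv` + anisotropy + (hR), (hP) for `𝓢_{λ′,a′}` at `v`, `μ_v = localMu L (toHeckeCharacter L λ′) v`; conclusion LITERALLY the
  letter's body at `v`).
* §3 `LemD1RankTwoCMLetters.lemD1_1AsPrintedNonsplitCM₂_of_forall_pinnedDichotomy` ∕ `lemD1_1AsPrintedCM₂_of_forall_pinnedDichotomy` — the letters from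
  (hR) ∧ (hP) at every anisotropic non-split place of every package.

HONEST SCOPE: nothing of [Liu2021] is asserted; implications between the tree's own statements (+ the construction §0b).  (hR) and (hP) are NOT proved
here: (hR) is ★ p849778 read on the CM section (road (R), B-p04 (g43)); (hP) — the vanishing of the coinvariants of the CM section's local Weil factor
at the character `μ_v|_{E_v¹}` of the centre, at an anisotropic non-split place — is the printed residue (road (P), LD2-p02 (g2)).  HC_CM is
proved only modulo the printed citations — the 2 remaining named inputs (hLiu418 = stmt-HodgeConjecture-24832, h413 = 24833) — until rung 0 closes; this
file touches no book.

## References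
* [Liu2021] Y. Liu, *Fourier–Jacobi cycles and arithmetic relative trace formula*, Camb. J. Math. 9 (2021) = arXiv:2102.11518, App. D Lemma D.1, first
  sentence + (1) (p. 125, l. 5226–5229); proof l. 5243–5245 (p. 126).
* [HarrisKudlaSweet1996] M. Harris, S. Kudla, W. J. Sweet, *Theta dichotomy for unitary groups*, J. AMS 9 (1996), Prop. 5.1 (iii), Thm. 6.1.
* [MoeglinVignerasWaldspurger1987] C. Mœglin, M.-F. Vignéras, J.-L. Waldspurger, LNM 1291 (1987), Chap. 3 IV.4 Thm principal.
* [Dieudonne1971GroupesClassiques] J. Dieudonné, *La géométrie des groupes classiques* (1971), Chap. II §5 (Hilbert 90 for a quadratic extension).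
-/

set_option autoImplicit false

noncomputable section

open scoped Matrix Kronecker TensorProduct Classical RestrictedProduct
open NumberField IsDedekindDomain Filter Set
open _root_.MeasureTheory
open Literature.NumberTheory Literature.NumberTheory.Automorphic Literature.NumberTheory.Automorphic.UnitaryGroup
open Literature.NumberTheory.Weil1964 Literature.RepresentationTheory
open Literature.RepresentationTheory.HeisenbergGroup
open Literature.RepresentationTheory.Liu2021 (OscillatorStandingData)
open Literature.RepresentationTheory.CentralCharacterQuotient (augmentation)
open Literature.RepresentationTheory.MoeglinVignerasWaldspurger1987

/-! ## §0 Hilbert 90 on the centre: every element of `U(J₁)(F_v)` is `θ(x/x̄)` -/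

namespace Literature.NumberTheory.Automorphic.Liu2021.LemD1OfPlace

variable {F : Type} (E : Type) [Field F] [NumberField F] [Field E] [NumberField E] [Algebra F E]
variable [Algebra.IsQuadraticExtension F E] (v : HeightOneSpectrum (𝓞 F)) (c : E ≃ₐ[F] E) (N : ℕ)
  (J : Matrix (Fin N) (Fin N) E) (J₁ : Matrix (Fin 1) (Fin 1) E)
variable {δ : E} (hcδ : c δ = -δ) (hδ : δ ≠ 0) (hN : 2 ≤ N) (hJh : (J.map c)ᵀ = J) (hJdet : J.det ≠ 0)

/-- **Hilbert 90 read on the centre**: at a place `v` with `E_v` a FIELD, every `u ∈ U(J₁)(F_v)` is `θ(x/x̄)` for some unit `x` of `E_v` — `u = θ(z)` with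
`z z̄ = 1` (★ `theta_surjective`), and `z = x/x̄` (★ `exists_unit_mul_conj_eq`: `x = 1 + z`, or `x = δ` when `z = −1`).
[cite: Dieudonne1971GroupesClassiques, Chap. II §5] [cite: Liu2021, App. D §D.1 l. 5224 («χ̌(x) = χ(x/x^c)»)] -/
theorem exists_theta_divConj_eq (hJ₁ : J₁ 0 0 ≠ 0) (hE : IsField (LocalRing E v)) (u : localPi E c 1 J₁ v) :
    ∃ x : (LocalRing E v)ˣ, theta E v c N J hcδ hδ hN hJh hJdet J₁ ((standingData E v c N J hcδ hδ hN hJh hJdet).divConj x) = u := by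
  obtain ⟨z, rfl⟩ := theta_surjective E v c N J hcδ hδ hN hJh hJdet J₁ hJ₁ u
  -- `z z̄ = 1`
  have hz : conjLocal E c v ((z : (LocalRing E v)ˣ) : LocalRing E v) * ((z : (LocalRing E v)ˣ) : LocalRing E v) = 1 := by
    rw [mul_comm]; exact mul_conjLocal_eq_one E v c N J hcδ hδ hN hJh hJdet z
  obtain ⟨x, hx⟩ := Literature.NumberTheory.GelbartRogawski1991.UnitaryDualPair.LocalSplitting.exists_unit_mul_conj_eq F E c hcδ hδ v hE _ hz
  refine ⟨x, congrArg _ ?_⟩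
  -- `x / x̄ = z` in `E_v¹ ≤ E_vˣ`: `x = z · x̄`
  apply Subtype.ext
  rw [OscillatorStandingData.coe_divConj, div_eq_iff_eq_mul]
  apply Units.ext
  rw [Units.val_mul, Units.coe_map, MonoidHom.coe_coe, OscillatorStandingData.σ_apply, standingData_conj_apply]
  exact hx.symm

/-- **Two characters of `U(J₁)(F_v)` that agree on every `θ(x/x̄)` are equal** (`E_v` a field; §0 surjectivity).
[cite: Dieudonne1971GroupesClassiques, Chap. II §5] -/
theorem eq_of_forall_apply_theta_divConj_eq (hJ₁ : J₁ 0 0 ≠ 0) (hE : IsField (LocalRing E v)) {M : Type*} [MulOneClass M]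
    (χ₁ χ₂ : localPi E c 1 J₁ v →* M)
    (h : ∀ x : (LocalRing E v)ˣ, χ₁ (theta E v c N J hcδ hδ hN hJh hJdet J₁ ((standingData E v c N J hcδ hδ hN hJh hJdet).divConj x)) =
      χ₂ (theta E v c N J hcδ hδ hN hJh hJdet J₁ ((standingData E v c N J hcδ hδ hN hJh hJdet).divConj x))) :
    χ₁ = χ₂ := by
  refine MonoidHom.ext fun u => ?_
  obtain ⟨x, rfl⟩ := exists_theta_divConj_eq E v c N J J₁ hcδ hδ hN hJh hJdet hJ₁ hE u
  exact h x

/-! ## §0b The `μ_v²`-character of the centre EXISTS: it is `μ_v` read on `E_v¹` (`μ_v(x)² = μ_v(x/x̄)`, the kernel clause of Step 2) -/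

/-- **«`χ̌ = μ²`» names the character `μ|_{E¹}` of the centre**: for Step 2's `μ_v` (unitary, continuous, `μ_v(a) = 1 ↔ a ∈ Nm E_vˣ` on `F_vˣ`)
the character `χμ := μ_v ∘ (u ↦ det u) : U(J₁)(F_v) → ℂˣ` is unitary, continuous, and satisfies `χμ(θ(x/x̄)) = μ_v(x/x̄) = μ_v(x)²` for every
unit `x` of `E_v` — because `μ_v(x x̄) = 1` (`x x̄` is a norm).  So the pinned character of [Liu2021, Lem. D.1 (1)] («`χ̌ = μ²`») exists on the
centre and is `μ_v|_{E_v¹}` transported along `θ`; used in §1 to pin the vanishing character.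
[cite: Liu2021, App. D §D.1 Step 2 (l. 5219), l. 5224; Lemma D.1 (1) (p. 125, l. 5229)] [cite: HarrisKudlaSweet1996, Prop. 5.1 (iii)] -/
theorem exists_centreChar_apply_theta_divConj_eq_mu_sq (μv : (LocalRing E v)ˣ →* ℂˣ) (hμn : ∀ x, ‖((μv x : ℂˣ) : ℂ)‖ = 1)
    (hμc : Continuous fun x => ((μv x : ℂˣ) : ℂ))
    (hμF : ∀ t : (v.adicCompletion F)ˣ,
      μv (Units.map (algebraMap (v.adicCompletion F) (LocalRing E v)).toMonoidHom t) = 1 ↔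
        ∃ x : (LocalRing E v)ˣ, (x : LocalRing E v) * conjLocal E c v x = algebraMap (v.adicCompletion F) (LocalRing E v) t) :
    ∃ χμ : localPi E c 1 J₁ v →* ℂˣ, (∀ u, ‖((χμ u : ℂˣ) : ℂ)‖ = 1) ∧ (Continuous fun u => ((χμ u : ℂˣ) : ℂ)) ∧
      ∀ x : (LocalRing E v)ˣ,
        χμ (theta E v c N J hcδ hδ hN hJh hJdet J₁ ((standingData E v c N J hcδ hδ hN hJh hJdet).divConj x)) = μv x ^ 2 := by
  -- `D u = det((GL_1(Π_w E_w) = Π_w GL_1(E_w))⁻¹ u) ∈ E_vˣ`, a continuous homomorphism with `D(θ z) = z`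
  let D : localPi E c 1 J₁ v →* (LocalRing E v)ˣ :=
    Matrix.GeneralLinearGroup.det.comp ((localGLPiEquiv E 1 v).symm.toMulEquiv.toMonoidHom.comp (localPi E c 1 J₁ v).subtype)
  have hDθ : ∀ z : (standingData E v c N J hcδ hδ hN hJh hJdet).normOne,
      D (theta E v c N J hcδ hδ hN hJh hJdet J₁ z) = (z : (LocalRing E v)ˣ) := by
    intro z
    apply Units.ext
    change (Units.val ((localGLPiEquiv E 1 v).symm
        ((theta E v c N J hcδ hδ hN hJh hJdet J₁ z : localPi E c 1 J₁ v) : LocalGLPi E 1 v))).det = _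
    rw [coe_theta, ContinuousMulEquiv.symm_apply_apply, OscillatorStandingData.coe_unitScalar, Matrix.det_fin_one,
      Matrix.scalar_apply, Matrix.diagonal_apply_eq]
  have hDc : Continuous D := by
    have hdet : Continuous (Matrix.GeneralLinearGroup.det : GL (Fin 1) (LocalRing E v) → (LocalRing E v)ˣ) :=
      Units.continuous_iff.2 ⟨Units.continuous_val.matrix_det, Units.continuous_coe_inv.matrix_det⟩
    exact hdet.comp ((localGLPiEquiv E 1 v).symm.continuous.comp continuous_subtype_val)
  refine ⟨μv.comp D, fun u => hμn _, hμc.comp hDc, fun x => ?_⟩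
  -- `μ_v(x x̄) = 1`: `x x̄ = ι_v(t)` is a norm
  have hfix : conjLocal E c v ((x : LocalRing E v) * conjLocal E c v x) = (x : LocalRing E v) * conjLocal E c v x := by
    rw [map_mul, conjLocal_conjLocal_apply E v c hcδ hδ, mul_comm]
  obtain ⟨p, hp⟩ := exists_toLocalRing_eq_of_conjLocal_eq E v c hcδ hδ _ hfix
  have hp0 : p ≠ 0 := by
    rintro rfl
    have hx0 : (x : LocalRing E v) * conjLocal E c v x = 0 := by rw [← hp, map_zero]
    exact (x * Units.map (conjLocal E c v).toMonoidHom x).ne_zero (by simpa using hx0)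
  have hnorm : μv (x * Units.map (conjLocal E c v).toMonoidHom x) = 1 := by
    have ht : Units.map (algebraMap (v.adicCompletion F) (LocalRing E v)).toMonoidHom (Units.mk0 p hp0) =
        x * Units.map (conjLocal E c v).toMonoidHom x :=
      Units.ext (by simpa [algebraMap_localRing_eq] using hp)
    rw [← ht]
    exact (hμF (Units.mk0 p hp0)).2 ⟨x, by simpa [algebraMap_localRing_eq] using hp.symm⟩
  -- `χμ(θ(x/x̄)) = μ_v(x/x̄) = μ_v(x) / μ_v(x̄) = μ_v(x)²`
  have hσ : Units.map ((standingData E v c N J hcδ hδ hN hJh hJdet).σ : LocalRing E v →* LocalRing E v) x =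
      Units.map (conjLocal E c v).toMonoidHom x :=
    Units.ext (by simp)
  rw [MonoidHom.comp_apply, hDθ, OscillatorStandingData.coe_divConj, hσ, map_div, div_eq_iff_eq_mul, sq, mul_assoc, ← map_mul,
    hnorm, mul_one]

end Literature.NumberTheory.Automorphic.Liu2021.LemD1OfPlace

/-! ## §1 Item (1) at a NON-SPLIT ANISOTROPIC place from the pinned centre dichotomy, on the datum `localLemD1DataAtV₂` (`N = 2`) -/

namespace Literature.NumberTheory.Automorphic.Liu2021.Def411WeilCarriers

open Literature.NumberTheory.GelbartRogawski1991 Literature.NumberTheory.GelbartRogawski1991.UnitaryDualPair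
open Literature.NumberTheory.GelbartRogawski1991.UnitaryDualPair.WeilCoinv
open Literature.NumberTheory.GelbartRogawski1991.GRConstruction

section AtV

variable (F E : Type) [Field F] [NumberField F] [Field E] [NumberField E] [Algebra F E]
variable (c : E ≃ₐ[F] E) (N : ℕ) {n : ℕ} (e : Fin N × Fin 1 ≃ Fin n)
variable (JV : Matrix (Fin N) (Fin N) E) {TV : Matrix (Fin N) (Fin N) F}
variable [Algebra.IsQuadraticExtension F E] {δ : E} (hcδ : c δ = -δ) (hδ : δ ≠ 0) {d : F} (hd : δ * δ = algebraMap F E d)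

/-- `2 ≤ N` when `2 ≤ n`, for `e : Fin N × Fin 1 ≃ Fin n` (`N = n`; plumbing, the rank proof fed to the standing data — any proof gives the same terms).
[folklore] -/
private theorem two_le_rank₂' (e : Fin N × Fin 1 ≃ Fin n) (hn : 2 ≤ n) : 2 ≤ N := by
  have h : N = n := by simpa using Fintype.card_congr e
  omega

/-- Reading of the datum's Step-3 slot: `χ_v` of `localLemD1DataAtV₂ … χ v` is `localCharOfCenter … χ v ∘ θ` (unfolding; the rank proof fed to `θ` is
irrelevant). [cite: Liu2021, App. D §D.1 Step 3 (l. 5221)] -/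
theorem chi_localLemD1DataAtV₂ (hV : TV.IsSymm) (hVd : IsUnit TV.det)
    (hJV : JV = TV.map (algebraMap F E)) (a : Fˣ)
    (𝓢 : LocalSplitting.FinLocalSplittings F E c n hcδ hδ hd (gram F e TV (TW F a)) (isSymm_gram F e hV (isSymm_TW F a))
      (reindex_kronecker_eq_gram_map F E e hJV (JW_eq F E a)))
    (hn : 2 ≤ n) (μ : ∀ v : HeightOneSpectrum (𝓞 F), (LocalRing E v)ˣ →* ℂˣ) (hμn : ∀ v x, ‖((μ v x : ℂˣ) : ℂ)‖ = 1)
    (hμc : ∀ v, Continuous fun x => ((μ v x : ℂˣ) : ℂ))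
    (hμF : ∀ (v : HeightOneSpectrum (𝓞 F)) (t : (v.adicCompletion F)ˣ),
      μ v (Units.map (algebraMap (v.adicCompletion F) (LocalRing E v)).toMonoidHom t) = 1 ↔
        ∃ x : (LocalRing E v)ˣ, (x : LocalRing E v) * conjLocal E c v x = algebraMap (v.adicCompletion F) (LocalRing E v) t)
    (χ : Chi F E c) (v : HeightOneSpectrum (𝓞 F)) (hN : 2 ≤ N) :
    (localLemD1DataAtV₂ F E c N e JV hcδ hδ hd hV hVd hJV a 𝓢 hn μ hμn hμc hμF χ v).chi =
      (localCharOfCenter F E c (JW F E a) (JW_apply_ne_zero F E a) χ.1 v).comp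
        (LemD1OfPlace.theta E v c N JV hcδ hδ hN (transpose_map_conj_JV F E c N JV hV hJV) (det_JV_ne_zero F E N JV hVd hJV) (JW F E a)) :=
  rfl

/-- Reading of the datum's standing data: it is `LemD1OfPlace.standingData` at `J_V` (unfolding; any rank proof). [cite: Liu2021, App. D §D.1 (l. 5213)] -/
theorem S_localLemD1DataAtV₂ (hV : TV.IsSymm) (hVd : IsUnit TV.det)
    (hJV : JV = TV.map (algebraMap F E)) (a : Fˣ)
    (𝓢 : LocalSplitting.FinLocalSplittings F E c n hcδ hδ hd (gram F e TV (TW F a)) (isSymm_gram F e hV (isSymm_TW F a))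
      (reindex_kronecker_eq_gram_map F E e hJV (JW_eq F E a)))
    (hn : 2 ≤ n) (μ : ∀ v : HeightOneSpectrum (𝓞 F), (LocalRing E v)ˣ →* ℂˣ) (hμn : ∀ v x, ‖((μ v x : ℂˣ) : ℂ)‖ = 1)
    (hμc : ∀ v, Continuous fun x => ((μ v x : ℂˣ) : ℂ))
    (hμF : ∀ (v : HeightOneSpectrum (𝓞 F)) (t : (v.adicCompletion F)ˣ),
      μ v (Units.map (algebraMap (v.adicCompletion F) (LocalRing E v)).toMonoidHom t) = 1 ↔
        ∃ x : (LocalRing E v)ˣ, (x : LocalRing E v) * conjLocal E c v x = algebraMap (v.adicCompletion F) (LocalRing E v) t)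
    (χ : Chi F E c) (v : HeightOneSpectrum (𝓞 F)) (hN : 2 ≤ N) :
    (localLemD1DataAtV₂ F E c N e JV hcδ hδ hd hV hVd hJV a 𝓢 hn μ hμn hμc hμF χ v).S =
      LemD1OfPlace.standingData E v c N JV hcδ hδ hN (transpose_map_conj_JV F E c N JV hV hJV) (det_JV_ne_zero F E N JV hVd hJV) :=
  rfl

/-- Reading of the datum's Step-2 slot: `μ` of `localLemD1DataAtV₂ … v` is `μ_v` (unfolding). [cite: Liu2021, App. D §D.1 Step 2 (l. 5219)] -/
theorem mu_localLemD1DataAtV₂ (hV : TV.IsSymm) (hVd : IsUnit TV.det)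
    (hJV : JV = TV.map (algebraMap F E)) (a : Fˣ)
    (𝓢 : LocalSplitting.FinLocalSplittings F E c n hcδ hδ hd (gram F e TV (TW F a)) (isSymm_gram F e hV (isSymm_TW F a))
      (reindex_kronecker_eq_gram_map F E e hJV (JW_eq F E a)))
    (hn : 2 ≤ n) (μ : ∀ v : HeightOneSpectrum (𝓞 F), (LocalRing E v)ˣ →* ℂˣ) (hμn : ∀ v x, ‖((μ v x : ℂˣ) : ℂ)‖ = 1)
    (hμc : ∀ v, Continuous fun x => ((μ v x : ℂˣ) : ℂ))
    (hμF : ∀ (v : HeightOneSpectrum (𝓞 F)) (t : (v.adicCompletion F)ˣ),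
      μ v (Units.map (algebraMap (v.adicCompletion F) (LocalRing E v)).toMonoidHom t) = 1 ↔
        ∃ x : (LocalRing E v)ˣ, (x : LocalRing E v) * conjLocal E c v x = algebraMap (v.adicCompletion F) (LocalRing E v) t)
    (χ : Chi F E c) (v : HeightOneSpectrum (𝓞 F)) :
    (localLemD1DataAtV₂ F E c N e JV hcδ hδ hd hV hVd hJV a 𝓢 hn μ hμn hμc hμF χ v).mu = μ v :=
  rfl

/-- **The datum's «χ̌_v(x)» READ on the centre**: `χ̌_v(x) = χ_v(θ(x/x̄))` for the datum `localLemD1DataAtV₂ … χ v` (unfolding of Step 3 + l. 5224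
«`χ̌(x) = χ(x/x^c)`»; any rank proof on the right). [cite: Liu2021, App. D §D.1 Step 3 (l. 5221), l. 5224] -/
theorem check_chi_localLemD1DataAtV₂_apply (hV : TV.IsSymm) (hVd : IsUnit TV.det)
    (hJV : JV = TV.map (algebraMap F E)) (a : Fˣ)
    (𝓢 : LocalSplitting.FinLocalSplittings F E c n hcδ hδ hd (gram F e TV (TW F a)) (isSymm_gram F e hV (isSymm_TW F a))
      (reindex_kronecker_eq_gram_map F E e hJV (JW_eq F E a)))
    (hn : 2 ≤ n) (μ : ∀ v : HeightOneSpectrum (𝓞 F), (LocalRing E v)ˣ →* ℂˣ) (hμn : ∀ v x, ‖((μ v x : ℂˣ) : ℂ)‖ = 1)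
    (hμc : ∀ v, Continuous fun x => ((μ v x : ℂˣ) : ℂ))
    (hμF : ∀ (v : HeightOneSpectrum (𝓞 F)) (t : (v.adicCompletion F)ˣ),
      μ v (Units.map (algebraMap (v.adicCompletion F) (LocalRing E v)).toMonoidHom t) = 1 ↔
        ∃ x : (LocalRing E v)ˣ, (x : LocalRing E v) * conjLocal E c v x = algebraMap (v.adicCompletion F) (LocalRing E v) t)
    (χ : Chi F E c) (v : HeightOneSpectrum (𝓞 F)) (hN : 2 ≤ N) (x : (LocalRing E v)ˣ) :
    (localLemD1DataAtV₂ F E c N e JV hcδ hδ hd hV hVd hJV a 𝓢 hn μ hμn hμc hμF χ v).S.check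
        (localLemD1DataAtV₂ F E c N e JV hcδ hδ hd hV hVd hJV a 𝓢 hn μ hμn hμc hμF χ v).chi x =
      localCharOfCenter F E c (JW F E a) (JW_apply_ne_zero F E a) χ.1 v
        (LemD1OfPlace.theta E v c N JV hcδ hδ hN (transpose_map_conj_JV F E c N JV hV hJV) (det_JV_ne_zero F E N JV hVd hJV) (JW F E a)
          ((LemD1OfPlace.standingData E v c N JV hcδ hδ hN (transpose_map_conj_JV F E c N JV hV hJV)
            (det_JV_ne_zero F E N JV hVd hJV)).divConj x)) :=
  rfl

/-- **[Liu2021, Lem. D.1, first sentence + (1)] AS PRINTED at a place `v` with `E_v` a FIELD where the rank-2 datum is ANISOTROPIC, FROM THE PINNED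
CENTRE DICHOTOMY — PROVED junction.**  Binders token for token those of ★ `lemD1_1AsPrinted_localLemD1DataAtV₂_of_isField_of_not_isAnisotropic` (p849478)
with `N = 2` (`hN2`), `han : (…).IsAnisotropic` in place of `hiso`, and the PINNED DICHOTOMY as two named inputs in the coinvariant currency of ★
`quotEquivLocalType₂` (`ω_v = 𝓢.omegaLoc v` along the local centre `U(⟨a⟩)(F_v)`): (hR) there is a character `χ₀` (open kernel) such that for every unitary
continuous `χ′` the `χ′`-coinvariants are non-zero iff `χ′ ≠ χ₀` (= ★ p849778's shape, any section); (hP) some `χ′` with `χ′(θ(x/x̄)) = μ_v(x)²` for all units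
`x` of `E_v` has zero coinvariants (the printed pin, vanishing direction [HarrisKudlaSweet1996, Prop. 5.1 (iii)]; all such `χ′` coincide, §0).  First sentence ★ ([MVW, IV.4]); item (1):
«⇒» the datum's `χ_v` has zero coinvariants, so `χ_v = χ₀` (hR), and `χ₀` is the `μ_v²`-character of §0b (it vanishes by (hP), uniqueness by (hR)), i.e.
`χ̌_v = μ_v²`; «⇐» `χ̌_v = μ_v²` is (hP)'s premise for `χ_v`.
[cite: Liu2021, App. D Lemma D.1 (1) (p. 125, l. 5226–5229); proof l. 5243–5245 (p. 126)] [cite: HarrisKudlaSweet1996, Prop. 5.1 (iii)]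
[cite: MoeglinVignerasWaldspurger1987, Chap. 3 IV.4 Thm principal 1a), 2a)] -/
theorem lemD1_1AsPrinted_localLemD1DataAtV₂_of_isField_of_isAnisotropic_of_pinnedDichotomy (hV : TV.IsSymm) (hVd : IsUnit TV.det)
    (hJV : JV = TV.map (algebraMap F E)) (a : Fˣ)
    (𝓢 : LocalSplitting.FinLocalSplittings F E c n hcδ hδ hd (gram F e TV (TW F a)) (isSymm_gram F e hV (isSymm_TW F a))
      (reindex_kronecker_eq_gram_map F E e hJV (JW_eq F E a)))
    (hn : 2 ≤ n) (μ : ∀ v : HeightOneSpectrum (𝓞 F), (LocalRing E v)ˣ →* ℂˣ) (hμn : ∀ v x, ‖((μ v x : ℂˣ) : ℂ)‖ = 1)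
    (hμc : ∀ v, Continuous fun x => ((μ v x : ℂˣ) : ℂ))
    (hμF : ∀ (v : HeightOneSpectrum (𝓞 F)) (t : (v.adicCompletion F)ˣ),
      μ v (Units.map (algebraMap (v.adicCompletion F) (LocalRing E v)).toMonoidHom t) = 1 ↔
        ∃ x : (LocalRing E v)ˣ, (x : LocalRing E v) * conjLocal E c v x = algebraMap (v.adicCompletion F) (LocalRing E v) t)
    (χ : Chi F E c) (v : HeightOneSpectrum (𝓞 F)) (hf : IsField (LocalRing E v)) (hN2 : N = 2)
    (han : (localLemD1DataAtV₂ F E c N e JV hcδ hδ hd hV hVd hJV a 𝓢 hn μ hμn hμc hμF χ v).IsAnisotropic)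
    (hR : ∃ χ₀ : localPi E c 1 (JW F E a) v →* ℂˣ, IsOpen (χ₀.ker : Set (localPi E c 1 (JW F E a) v)) ∧
      ∀ χ' : localPi E c 1 (JW F E a) v →* ℂˣ, (∀ u, ‖((χ' u : ℂˣ) : ℂ)‖ = 1) → (Continuous fun u => ((χ' u : ℂˣ) : ℂ)) →
        (Nontrivial (TwistedCoinv.Coinv
          (show Representation ℂ (localPi E c 1 (JW F E a) v) (SchwartzBruhat (Fin n → v.adicCompletion F)) from
            (𝓢.omegaLoc v).comp (localCenter E c n (Matrix.reindex e e (JV ⊗ₖ JW F E a)) (JW F E a) (JW_apply_ne_zero F E a) v)) χ') ↔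
          χ' ≠ χ₀))
    (hP : ∃ χ' : localPi E c 1 (JW F E a) v →* ℂˣ,
      (∀ x : (LocalRing E v)ˣ,
        χ' (LemD1OfPlace.theta E v c N JV hcδ hδ (two_le_rank₂' N e hn) (transpose_map_conj_JV F E c N JV hV hJV)
            (det_JV_ne_zero F E N JV hVd hJV) (JW F E a)
          ((LemD1OfPlace.standingData E v c N JV hcδ hδ (two_le_rank₂' N e hn) (transpose_map_conj_JV F E c N JV hV hJV)
            (det_JV_ne_zero F E N JV hVd hJV)).divConj x)) = μ v x ^ 2) ∧
      Subsingleton (TwistedCoinv.Coinv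
          (show Representation ℂ (localPi E c 1 (JW F E a) v) (SchwartzBruhat (Fin n → v.adicCompletion F)) from
            (𝓢.omegaLoc v).comp (localCenter E c n (Matrix.reindex e e (JV ⊗ₖ JW F E a)) (JW F E a) (JW_apply_ne_zero F E a) v)) χ')) :
    LemD1_1AsPrinted (localLemD1DataAtV₂ F E c N e JV hcδ hδ hd hV hVd hJV a 𝓢 hn μ hμn hμc hμF χ v) := by
  -- the first sentence ([MVW, IV.4] PROVED, ★ B-typ04)
  have h12 := isIrreducibleOrZero_and_isAdmissible_localLemD1DataAtV₂_of_isField F E c N e JV hcδ hδ hd hV hVd hJV a 𝓢 hn μ hμn hμc hμF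
    χ v hf
  obtain ⟨χ₀, -, hdich⟩ := hR
  obtain ⟨χμ, hμu', hμc', hχμ⟩ := LemD1OfPlace.exists_centreChar_apply_theta_divConj_eq_mu_sq E v c N JV (JW F E a) hcδ hδ
    (two_le_rank₂' N e hn) (transpose_map_conj_JV F E c N JV hV hJV) (det_JV_ne_zero F E N JV hVd hJV) (μ v) (hμn v) (hμc v) (hμF v)
  -- every pinned character IS `χ'` (Hilbert 90, §0), so every pinned character has zero coinvariants
  obtain ⟨χ', hχ', hP'⟩ := hP
  have hPall : ∀ χ'' : localPi E c 1 (JW F E a) v →* ℂˣ,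
      (∀ x : (LocalRing E v)ˣ,
        χ'' (LemD1OfPlace.theta E v c N JV hcδ hδ (two_le_rank₂' N e hn) (transpose_map_conj_JV F E c N JV hV hJV)
            (det_JV_ne_zero F E N JV hVd hJV) (JW F E a)
          ((LemD1OfPlace.standingData E v c N JV hcδ hδ (two_le_rank₂' N e hn) (transpose_map_conj_JV F E c N JV hV hJV)
            (det_JV_ne_zero F E N JV hVd hJV)).divConj x)) = μ v x ^ 2) →
      Subsingleton (TwistedCoinv.Coinv
          (show Representation ℂ (localPi E c 1 (JW F E a) v) (SchwartzBruhat (Fin n → v.adicCompletion F)) from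
            (𝓢.omegaLoc v).comp (localCenter E c n (Matrix.reindex e e (JV ⊗ₖ JW F E a)) (JW F E a) (JW_apply_ne_zero F E a) v)) χ'') := by
    intro χ'' hχ''
    have h : χ'' = χ' :=
      LemD1OfPlace.eq_of_forall_apply_theta_divConj_eq E v c N JV (JW F E a) hcδ hδ (two_le_rank₂' N e hn)
        (transpose_map_conj_JV F E c N JV hV hJV) (det_JV_ne_zero F E N JV hVd hJV) (JW_apply_ne_zero F E a) hf _ _
        fun x => (hχ'' x).trans (hχ' x).symm
    rw [h]
    exact hP'
  -- the pin of `χ₀`: the `μ_v²`-character has zero coinvariants (hP), hence IS the vanishing character (hR)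
  have hμ0 : χμ = χ₀ := by
    by_contra hne
    haveI := hPall χμ hχμ
    exact not_nontrivial _ ((hdich χμ hμu' hμc').2 hne)
  have hχ₀ : ∀ x : (LocalRing E v)ˣ,
      χ₀ (LemD1OfPlace.theta E v c N JV hcδ hδ (two_le_rank₂' N e hn) (transpose_map_conj_JV F E c N JV hV hJV)
          (det_JV_ne_zero F E N JV hVd hJV) (JW F E a)
        ((LemD1OfPlace.standingData E v c N JV hcδ hδ (two_le_rank₂' N e hn) (transpose_map_conj_JV F E c N JV hV hJV)
          (det_JV_ne_zero F E N JV hVd hJV)).divConj x)) = μ v x ^ 2 := fun x => by rw [← hμ0]; exact hχμ x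
  -- the datum's `χ_v` is unitary and continuous
  have hχu : ∀ u, ‖((localCharOfCenter F E c (JW F E a) (JW_apply_ne_zero F E a) χ.1 v u : ℂˣ) : ℂ)‖ = 1 :=
    norm_localCharOfCenter F E c (JW F E a) (JW_apply_ne_zero F E a)
      (norm_chi_eq_one F E c (Algebra.IsQuadraticExtension.finrank_eq_two F E) (UnitaryGroup.algEquiv_ne_one_of_apply_eq_neg F E c hcδ hδ) χ) v
  have hχc : Continuous fun u => ((localCharOfCenter F E c (JW F E a) (JW_apply_ne_zero F E a) χ.1 v u : ℂˣ) : ℂ) :=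
    continuous_coe_localCharOfCenter F E c (JW F E a) (JW_apply_ne_zero F E a) χ.2.1 v
  have hd' := hdich _ hχu hχc
  -- `ω(μ_v, ε_v, χ_v) ≅ Coinv_{χ_v}` (★ `quotEquivLocalType₂`) on the level of `Nontrivial`
  have hq : Nontrivial (SchwartzBruhat (Fin n → v.adicCompletion F) ⧸
      augmentation (localLemD1DataAtV₂ F E c N e JV hcδ hδ hd hV hVd hJV a 𝓢 hn μ hμn hμc hμF χ v).omega
        (localLemD1DataAtV₂ F E c N e JV hcδ hδ hd hV hVd hJV a 𝓢 hn μ hμn hμc hμF χ v).S.scalar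
        (localLemD1DataAtV₂ F E c N e JV hcδ hδ hd hV hVd hJV a 𝓢 hn μ hμn hμc hμF χ v).chi) ↔
      Nontrivial (TwistedCoinv.Coinv
          (show Representation ℂ (localPi E c 1 (JW F E a) v) (SchwartzBruhat (Fin n → v.adicCompletion F)) from
            (𝓢.omegaLoc v).comp (localCenter E c n (Matrix.reindex e e (JV ⊗ₖ JW F E a)) (JW F E a) (JW_apply_ne_zero F E a) v))
          (localCharOfCenter F E c (JW F E a) (JW_apply_ne_zero F E a) χ.1 v)) :=
    (quotEquivLocalType₂ F E c N e JV hcδ hδ hd hV hVd hJV a 𝓢 hn μ hμn hμc hμF χ v).toLinearEquiv.toEquiv.nontrivial_congr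
  refine ⟨h12, ⟨fun hsub => ⟨hf, ⟨han, hN2⟩, fun x => ?_⟩, fun hrhs => ?_⟩⟩
  · -- «⇒»: `ω = 0` ⇒ `Coinv_{χ_v} = 0` ⇒ `χ_v = χ₀` ⇒ the pin
    have h0 : ¬ Nontrivial (TwistedCoinv.Coinv
          (show Representation ℂ (localPi E c 1 (JW F E a) v) (SchwartzBruhat (Fin n → v.adicCompletion F)) from
            (𝓢.omegaLoc v).comp (localCenter E c n (Matrix.reindex e e (JV ⊗ₖ JW F E a)) (JW F E a) (JW_apply_ne_zero F E a) v))
          (localCharOfCenter F E c (JW F E a) (JW_apply_ne_zero F E a) χ.1 v)) :=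
      fun h => (not_nontrivial_iff_subsingleton.2 hsub) (hq.2 h)
    have heq : localCharOfCenter F E c (JW F E a) (JW_apply_ne_zero F E a) χ.1 v = χ₀ := by
      by_contra hne
      exact h0 (hd'.2 hne)
    rw [check_chi_localLemD1DataAtV₂_apply F E c N e JV hcδ hδ hd hV hVd hJV a 𝓢 hn μ hμn hμc hμF χ v (two_le_rank₂' N e hn),
      mu_localLemD1DataAtV₂ F E c N e JV hcδ hδ hd hV hVd hJV a 𝓢 hn μ hμn hμc hμF χ v, heq]
    exact hχ₀ x
  · -- «⇐»: `χ̌_v = μ_v²` ⇒ `Coinv_{χ_v} = 0` (hP) ⇒ `ω = 0`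
    obtain ⟨-, -, hx⟩ := hrhs
    simp only [check_chi_localLemD1DataAtV₂_apply F E c N e JV hcδ hδ hd hV hVd hJV a 𝓢 hn μ hμn hμc hμF χ v (two_le_rank₂' N e hn),
      mu_localLemD1DataAtV₂ F E c N e JV hcδ hδ hd hV hVd hJV a 𝓢 hn μ hμn hμc hμF χ v] at hx
    haveI := hPall _ hx
    exact not_nontrivial_iff_subsingleton.1 fun h => not_nontrivial _ (hq.1 h)

end AtV

/-! ## §2 The reading on the rank-2 CM θ-package of the letter ★ `LemD1RankTwoCMLetters.LemD1_1AsPrintedNonsplitCM₂`, at ONE anisotropic non-split place -/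

section CM

open NumberField.mixedEmbedding NumberField.InfinitePlace
open Literature.NumberTheory.GaloisRepresentations Literature.RepresentationTheory.HarrisKudlaSweet1996
open Literature.NumberTheory.Automorphic.IdeleClassGroup Literature.RepresentationTheory.Liu2021
open Literature.NumberTheory.Automorphic.Liu2021.Def411WeilCarriersDoubling
open Literature.NumberTheory.GelbartRogawski1991.UnitaryDualPair.LocalSplitting

-- the CM tokens are large: three hypotheses over the θ-package's local Weil factor, unified against §1 (junction budget)
set_option maxHeartbeats 800000 in
/-- **[Liu2021, Lem. D.1, first sentence + (1)] AS PRINTED on the rank-2 CM θ-package `(λ′, a′, χ)` at a NON-SPLIT finite place `v` of `L⁺` where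
the plane `(L_v², diag dV)` is ANISOTROPIC, FROM THE PINNED CENTRE DICHOTOMY at `v` — PROVED junction.**  Binders = those of the letter ★
`LemD1RankTwoCMLetters.LemD1_1AsPrintedNonsplitCM₂` at ONE place `v`, its non-split guard `hv`, the anisotropy hypothesis `han` on the letter's own datum
term, and the two inputs of §1 read on the CM section `𝓢_{λ′,a′}` at `v` (`μ_v = localMu L (toHeckeCharacter L λ′) v`): **(hR)** ★ p849778's shape on
`ω_v = 𝓢_{λ′,a′}.omegaLoc v` along the centre `U(⟨a′⟩)(L⁺_v)` («exactly one unitary continuous character has vanishing coinvariants»), **(hP)** «some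
character `χ′` of `U(⟨a′⟩)(L⁺_v)` with `χ′(θ(x/x̄)) = μ_v(x)²` has zero coinvariants» (the printed pin, vanishing direction; e.g. `χ′ = μ_v ∘ det`, §0b).  Conclusion
LITERALLY the letter's body at `v`.  `E_v = LocalRing L v` is a field by the contrapositive of ★
`SplitPlace.exists_placesOver_smul_ne_of_not_isField`, then §1 (`N = 2` by `rfl`).
[cite: Liu2021, App. D Lemma D.1 (1) (p. 125, l. 5226–5229); proof l. 5243–5245 (p. 126)] [cite: HarrisKudlaSweet1996, Prop. 5.1 (iii)]
[cite: MoeglinVignerasWaldspurger1987, Chap. 3 IV.4 Thm principal 1a), 2a)] -/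
theorem lemD1_1AsPrinted_localLemD1DataAtV₂_cm_of_forall_smul_eq_of_isAnisotropic_of_pinnedDichotomy
    (L : Type) [Field L] [NumberField L] [IsCMField L]
      (dV : Fin 2 → L) (hdV : ∀ i, IsCMField.complexConj L (dV i) = dV i) (hdV0 : ∀ i, dV i ≠ 0)
      {n' : ℕ} (e₁ : Fin 2 × Fin 1 ≃ Fin n')
      (χ : Chi (↥(maximalRealSubfield L)) L (IsCMField.complexConj L)) (a' : (↥(maximalRealSubfield L))ˣ)
      (lam' : Literature.NumberTheory.Automorphic.IdeleClassGroup L →ₜ* Circle) (hlam' : IsConjugateSymplectic L lam')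
      (v : HeightOneSpectrum (𝓞 ↥(maximalRealSubfield L)))
    (hv : ∀ w : UnitaryGroup.PlacesOver L v, IsCMField.complexConj L • (w : HeightOneSpectrum (𝓞 L)) = w)
    (han : (localLemD1DataAtV₂ (Fp L) L (IsCMField.complexConj L) 2 e₁ (Matrix.diagonal dV) (complexConj_imagUnit L)
        (imagUnit_ne_zero L) (imagUnit_mul_self L) (realDiagonal_isSymm L dV hdV) (isUnit_det_realDiagonal L dV hdV hdV0)
        (realDiagonal_map L dV hdV).symm a' (congrW L e₁ dV hdV (lineW L (TW (Fp L) a')) (complexConj_lineW L (TW (Fp L) a')) (realDiagonal_lineW L (TW (Fp L) a')) (diagonal_lineW L (TW (Fp L) a') (JW_eq (Fp L) L a')) (undoubledSplittings L e₁ dV hdV hdV0 (lineW L (TW (Fp L) a')) (complexConj_lineW L (TW (Fp L) a')) (lineW_ne_zero L (TW (Fp L) a') (isUnit_det_TW (Fp L) a')) (toHeckeCharacter L lam') (borelPlaceMeasure L) (cmFinLocalFamily L e₁ dV hdV hdV0 (lineW L (TW (Fp L) a')) (complexConj_lineW L (TW (Fp L) a')) (lineW_ne_zero L (TW (Fp L)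 a') (isUnit_det_TW (Fp L) a')) (toHeckeCharacter L lam') ((isOscillatorChar_toHeckeCharacter_iff lam').mpr hlam') (borelPlaceMeasure L))) (isSymm_TW (Fp L) a') (JW_eq (Fp L) L a')) (by -- `2 ≤ n'` (§D.1 «rank n ≥ 2»); the assembler's proof argument here is `two_le_of_finTwo_equiv e₁`
          have h := Fintype.card_congr e₁
          simp only [Fintype.card_prod, Fintype.card_fin, mul_one] at h
          omega)
        (localMu L (toHeckeCharacter L lam')) (fun v x => norm_localMu L (toHeckeCharacter L lam') v (isUnitary_toHeckeCharacter L lam') x)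
        (continuous_localMu L (toHeckeCharacter L lam'))
        (fun v t => localMu_toLocalRing_eq_one_iff L (toHeckeCharacter L lam') v ((isOscillatorChar_toHeckeCharacter_iff lam').mpr hlam') t)
        χ v).IsAnisotropic)
    (hR : (∃ χ₀ : localPi L (IsCMField.complexConj L) 1 (JW (Fp L) L a') v →* ℂˣ, IsOpen (χ₀.ker : Set (localPi L (IsCMField.complexConj L) 1 (JW (Fp L) L a') v)) ∧
        ∀ χ' : localPi L (IsCMField.complexConj L) 1 (JW (Fp L) L a') v →* ℂˣ, (∀ u, ‖((χ' u : ℂˣ) : ℂ)‖ = 1) → (Continuous fun u => ((χ' u : ℂˣ) : ℂ)) →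
          (Nontrivial (TwistedCoinv.Coinv (show Representation ℂ (localPi L (IsCMField.complexConj L) 1 (JW (Fp L) L a') v) (SchwartzBruhat (Fin n' → v.adicCompletion (Fp L))) from
            ((congrW L e₁ dV hdV (lineW L (TW (Fp L) a')) (complexConj_lineW L (TW (Fp L) a')) (realDiagonal_lineW L (TW (Fp L) a')) (diagonal_lineW L (TW (Fp L) a') (JW_eq (Fp L) L a')) (undoubledSplittings L e₁ dV hdV hdV0 (lineW L (TW (Fp L) a')) (complexConj_lineW L (TW (Fp L) a')) (lineW_ne_zero L (TW (Fp L) a') (isUnit_det_TW (Fp L) a')) (toHeckeCharacter L lam') (borelPlaceMeasure L) (cmFinLocalFamily L e₁ dV hdV hdV0 (lineW L (TW (Fp L) a')) (complexConj_lineW L (TW (Fp L) a')) (lineW_ne_zero L (TW (Fp L) a') (isUnit_det_TW (Fp L) a')) (toHeckeCharacter L lam') ((isOscillatorChar_toHeckeCharacter_iff lam').mpr hlam') (borelPlaceMeasure L))) (isSymm_TW (Fp L) a') (JW_eq (Fp L) L a')).omegaLoc v).comp (localCenter L (IsCMField.complexConj L) n' (Matrix.reindex e₁ e₁ (Matrix.diagonal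 dV ⊗ₖ JW (Fp L) L a')) (JW (Fp L) L a')
              (JW_apply_ne_zero (Fp L) L a') v)) χ') ↔ χ' ≠ χ₀)))
    (hP : (∃ χ' : localPi L (IsCMField.complexConj L) 1 (JW (Fp L) L a') v →* ℂˣ, (∀ x : (LocalRing L v)ˣ, χ' ((LemD1OfPlace.theta L v (IsCMField.complexConj L) 2 (Matrix.diagonal dV) (complexConj_imagUnit L) (imagUnit_ne_zero L) (le_refl 2) (transpose_map_conj_JV (Fp L) L (IsCMField.complexConj L) 2 (Matrix.diagonal dV) (realDiagonal_isSymm L dV hdV) (realDiagonal_map L dV hdV).symm) (det_JV_ne_zero (Fp L) L 2 (Matrix.diagonal dV) (isUnit_det_realDiagonal L dV hdV hdV0) (realDiagonal_map L dV hdV).symm) (JW (Fp L) L a')) ((LemD1OfPlace.standingData L v (IsCMField.complexConj L) 2 (Matrix.diagonal dV) (complexConj_imagUnit L) (imagUnit_ne_zero L) (le_refl 2) (transpose_map_conj_JV (Fp L) L (IsCMField.complexConj L) 2 (Matrix.diagonal dV) (realDiagonal_isSymm L dV hdV) (realDiagonal_map L dV hdV).symm) (det_JV_ne_zero (Fp L)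 L 2 (Matrix.diagonal dV) (isUnit_det_realDiagonal L dV hdV hdV0) (realDiagonal_map L dV hdV).symm)).divConj x)) = localMu L (toHeckeCharacter L lam') v x ^ 2) ∧
        Subsingleton (TwistedCoinv.Coinv (show Representation ℂ (localPi L (IsCMField.complexConj L) 1 (JW (Fp L) L a') v) (SchwartzBruhat (Fin n' → v.adicCompletion (Fp L))) from
            ((congrW L e₁ dV hdV (lineW L (TW (Fp L) a')) (complexConj_lineW L (TW (Fp L) a')) (realDiagonal_lineW L (TW (Fp L) a')) (diagonal_lineW L (TW (Fp L) a') (JW_eq (Fp L) L a')) (undoubledSplittings L e₁ dV hdV hdV0 (lineW L (TW (Fp L) a')) (complexConj_lineW L (TW (Fp L) a')) (lineW_ne_zero L (TW (Fp L) a') (isUnit_det_TW (Fp L) a')) (toHeckeCharacter L lam') (borelPlaceMeasure L) (cmFinLocalFamily L e₁ dV hdV hdV0 (lineW L (TW (Fp L) a')) (complexConj_lineW L (TW (Fp L) a')) (lineW_ne_zero L (TW (Fp L) a') (isUnit_det_TW (Fp L) a')) (toHeckeCharacter L lam') ((isOscillatorChar_toHeckeCharacter_iff lam').mpr hlam') (borelPlaceMeasure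 L))) (isSymm_TW (Fp L) a') (JW_eq (Fp L) L a')).omegaLoc v).comp (localCenter L (IsCMField.complexConj L) n' (Matrix.reindex e₁ e₁ (Matrix.diagonal dV ⊗ₖ JW (Fp L) L a')) (JW (Fp L) L a')
              (JW_apply_ne_zero (Fp L) L a') v)) χ'))) :
    LemD1_1AsPrinted (localLemD1DataAtV₂ (Fp L) L (IsCMField.complexConj L) 2 e₁ (Matrix.diagonal dV) (complexConj_imagUnit L)
        (imagUnit_ne_zero L) (imagUnit_mul_self L) (realDiagonal_isSymm L dV hdV) (isUnit_det_realDiagonal L dV hdV hdV0)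
        (realDiagonal_map L dV hdV).symm a' (congrW L e₁ dV hdV (lineW L (TW (Fp L) a')) (complexConj_lineW L (TW (Fp L) a')) (realDiagonal_lineW L (TW (Fp L) a')) (diagonal_lineW L (TW (Fp L) a') (JW_eq (Fp L) L a')) (undoubledSplittings L e₁ dV hdV hdV0 (lineW L (TW (Fp L) a')) (complexConj_lineW L (TW (Fp L) a')) (lineW_ne_zero L (TW (Fp L) a') (isUnit_det_TW (Fp L) a')) (toHeckeCharacter L lam') (borelPlaceMeasure L) (cmFinLocalFamily L e₁ dV hdV hdV0 (lineW L (TW (Fp L) a')) (complexConj_lineW L (TW (Fp L) a')) (lineW_ne_zero L (TW (Fp L) a') (isUnit_det_TW (Fp L) a')) (toHeckeCharacter L lam') ((isOscillatorChar_toHeckeCharacter_iff lam').mpr hlam') (borelPlaceMeasure L))) (isSymm_TW (Fp L) a') (JW_eq (Fp L) L a')) (by -- `2 ≤ n'` (§D.1 «rank n ≥ 2»); the assembler's proof argument here is `two_le_of_finTwo_equiv e₁`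
          have h := Fintype.card_congr e₁
          simp only [Fintype.card_prod, Fintype.card_fin, mul_one] at h
          omega)
        (localMu L (toHeckeCharacter L lam')) (fun v x => norm_localMu L (toHeckeCharacter L lam') v (isUnitary_toHeckeCharacter L lam') x)
        (continuous_localMu L (toHeckeCharacter L lam'))
        (fun v t => localMu_toLocalRing_eq_one_iff L (toHeckeCharacter L lam') v ((isOscillatorChar_toHeckeCharacter_iff lam').mpr hlam') t)
        χ v) := by
  have hf : IsField (LocalRing L v) := by
    by_contra h
    obtain ⟨w, hw⟩ := SplitPlace.exists_placesOver_smul_ne_of_not_isField L v (IsCMField.complexConj L)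
      (UnitaryGroup.algEquiv_ne_one_of_apply_eq_neg (Fp L) L (IsCMField.complexConj L) (complexConj_imagUnit L) (imagUnit_ne_zero L)) h
    exact hw (hv w)
  exact lemD1_1AsPrinted_localLemD1DataAtV₂_of_isField_of_isAnisotropic_of_pinnedDichotomy (Fp L) L (IsCMField.complexConj L) 2 e₁
    (Matrix.diagonal dV) (complexConj_imagUnit L) (imagUnit_ne_zero L) (imagUnit_mul_self L) (realDiagonal_isSymm L dV hdV)
    (isUnit_det_realDiagonal L dV hdV hdV0) (realDiagonal_map L dV hdV).symm a'
    (congrW L e₁ dV hdV (lineW L (TW (Fp L) a')) (complexConj_lineW L (TW (Fp L) a')) (realDiagonal_lineW L (TW (Fp L) a')) (diagonal_lineW L (TW (Fp L) a') (JW_eq (Fp L) L a')) (undoubledSplittings L e₁ dV hdV hdV0 (lineW L (TW (Fp L) a')) (complexConj_lineW L (TW (Fp L) a')) (lineW_ne_zero L (TW (Fp L) a') (isUnit_det_TW (Fp L) a')) (toHeckeCharacter L lam') (borelPlaceMeasure L) (cmFinLocalFamily L e₁ dV hdV hdV0 (lineW L (TW (Fp L) a')) (complexConj_lineW L (TW (Fp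 L) a')) (lineW_ne_zero L (TW (Fp L) a') (isUnit_det_TW (Fp L) a')) (toHeckeCharacter L lam') ((isOscillatorChar_toHeckeCharacter_iff lam').mpr hlam') (borelPlaceMeasure L))) (isSymm_TW (Fp L) a') (JW_eq (Fp L) L a'))
    (by
      have h := Fintype.card_congr e₁
      simp only [Fintype.card_prod, Fintype.card_fin, mul_one] at h
      omega)
    (localMu L (toHeckeCharacter L lam')) (fun v x => norm_localMu L (toHeckeCharacter L lam') v (isUnitary_toHeckeCharacter L lam') x)
    (continuous_localMu L (toHeckeCharacter L lam'))
    (fun v t => localMu_toLocalRing_eq_one_iff L (toHeckeCharacter L lam') v ((isOscillatorChar_toHeckeCharacter_iff lam').mpr hlam') t)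
    χ v hf rfl han hR hP

end CM

end Literature.NumberTheory.Automorphic.Liu2021.Def411WeilCarriers

/-! ## §3 The letters ★ `LemD1_1AsPrintedNonsplitCM₂` ∕ ★ `LemD1_1AsPrintedCM₂` from the pinned centre dichotomy at every anisotropic non-split place -/

namespace Literature.NumberTheory.Automorphic.Liu2021.LemD1RankTwoCMLetters

open NumberField.mixedEmbedding NumberField.InfinitePlace
open Literature.NumberTheory.GelbartRogawski1991 Literature.NumberTheory.GelbartRogawski1991.UnitaryDualPair
open Literature.NumberTheory.GelbartRogawski1991.UnitaryDualPair.WeilCoinv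
open Literature.NumberTheory.GelbartRogawski1991.UnitaryDualPair.LocalSplitting
open Literature.NumberTheory.GelbartRogawski1991.GRConstruction
open Literature.NumberTheory.GaloisRepresentations Literature.RepresentationTheory.HarrisKudlaSweet1996
open Literature.NumberTheory.Automorphic.IdeleClassGroup Literature.RepresentationTheory.Liu2021
open Literature.NumberTheory.Automorphic.Liu2021.Def411WeilCarriers
open Literature.NumberTheory.Automorphic.Liu2021.Def411WeilCarriersDoubling

set_option maxHeartbeats 800000 in
/-- **The non-split letter ★ `LemD1_1AsPrintedNonsplitCM₂` ([Liu2021, Lem. D.1, first sentence + (1)] on the rank-2 CM θ-packages at the non-split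
places) FROM THE PINNED CENTRE DICHOTOMY AT THE ANISOTROPIC NON-SPLIT PLACES.**  Hypothesis `h`: for every CM field `L`, frame `dV`, `e₁`, `χ`, line `a′`,
conjugate-symplectic `λ′` and every non-split finite place `v` of `L⁺` at which the letter's datum is anisotropic, the two inputs (hR) ∧ (hP) of §2
hold for `𝓢_{λ′,a′}` at `v`.  Then the letter holds (§2 at the anisotropic places, ★ `lemD1_1AsPrintedNonsplitCM₂_of_forall_isAnisotropic` — whose
isotropic half is ★ p849478 — for the rest).
[cite: Liu2021, App. D Lemma D.1 (1) (p. 125, l. 5226–5229); proof l. 5241–5245 (p. 126)] [cite: HarrisKudlaSweet1996, Prop. 5.1 (iii)]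
[cite: MoeglinVignerasWaldspurger1987, Chap. 3 IV.2; IV.4] -/
theorem lemD1_1AsPrintedNonsplitCM₂_of_forall_pinnedDichotomy
    (h : ∀ (L : Type) [Field L] [NumberField L] [IsCMField L]
      (dV : Fin 2 → L) (hdV : ∀ i, IsCMField.complexConj L (dV i) = dV i) (hdV0 : ∀ i, dV i ≠ 0)
      {n' : ℕ} (e₁ : Fin 2 × Fin 1 ≃ Fin n')
      (χ : Chi (↥(maximalRealSubfield L)) L (IsCMField.complexConj L)) (a' : (↥(maximalRealSubfield L))ˣ)
      (lam' : Literature.NumberTheory.Automorphic.IdeleClassGroup L →ₜ* Circle) (hlam' : IsConjugateSymplectic L lam')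
      (v : HeightOneSpectrum (𝓞 ↥(maximalRealSubfield L))),
      (∀ w : UnitaryGroup.PlacesOver L v, IsCMField.complexConj L • (w : HeightOneSpectrum (𝓞 L)) = w) →
      (localLemD1DataAtV₂ (Fp L) L (IsCMField.complexConj L) 2 e₁ (Matrix.diagonal dV) (complexConj_imagUnit L)
        (imagUnit_ne_zero L) (imagUnit_mul_self L) (realDiagonal_isSymm L dV hdV) (isUnit_det_realDiagonal L dV hdV hdV0)
        (realDiagonal_map L dV hdV).symm a' (congrW L e₁ dV hdV (lineW L (TW (Fp L) a')) (complexConj_lineW L (TW (Fp L) a')) (realDiagonal_lineW L (TW (Fp L) a')) (diagonal_lineW L (TW (Fp L) a') (JW_eq (Fp L) L a')) (undoubledSplittings L e₁ dV hdV hdV0 (lineW L (TW (Fp L) a')) (complexConj_lineW L (TW (Fp L) a')) (lineW_ne_zero L (TW (Fp L) a') (isUnit_det_TW (Fp L) a')) (toHeckeCharacter L lam') (borelPlaceMeasure L) (cmFinLocalFamily L e₁ dV hdV hdV0 (lineW L (TW (Fp L) a')) (complexConj_lineW L (TW (Fp L) a')) (lineW_ne_zero L (TW (Fp L) a') (isUnit_det_TW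 (Fp L) a')) (toHeckeCharacter L lam') ((isOscillatorChar_toHeckeCharacter_iff lam').mpr hlam') (borelPlaceMeasure L))) (isSymm_TW (Fp L) a') (JW_eq (Fp L) L a')) (by -- `2 ≤ n'` (§D.1 «rank n ≥ 2»); the assembler's proof argument here is `two_le_of_finTwo_equiv e₁`
          have h := Fintype.card_congr e₁
          simp only [Fintype.card_prod, Fintype.card_fin, mul_one] at h
          omega)
        (localMu L (toHeckeCharacter L lam')) (fun v x => norm_localMu L (toHeckeCharacter L lam') v (isUnitary_toHeckeCharacter L lam') x)
        (continuous_localMu L (toHeckeCharacter L lam'))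
        (fun v t => localMu_toLocalRing_eq_one_iff L (toHeckeCharacter L lam') v ((isOscillatorChar_toHeckeCharacter_iff lam').mpr hlam') t)
        χ v).IsAnisotropic →
      (∃ χ₀ : localPi L (IsCMField.complexConj L) 1 (JW (Fp L) L a') v →* ℂˣ, IsOpen (χ₀.ker : Set (localPi L (IsCMField.complexConj L) 1 (JW (Fp L) L a') v)) ∧
        ∀ χ' : localPi L (IsCMField.complexConj L) 1 (JW (Fp L) L a') v →* ℂˣ, (∀ u, ‖((χ' u : ℂˣ) : ℂ)‖ = 1) → (Continuous fun u => ((χ' u : ℂˣ) : ℂ)) →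
          (Nontrivial (TwistedCoinv.Coinv (show Representation ℂ (localPi L (IsCMField.complexConj L) 1 (JW (Fp L) L a') v) (SchwartzBruhat (Fin n' → v.adicCompletion (Fp L))) from
            ((congrW L e₁ dV hdV (lineW L (TW (Fp L) a')) (complexConj_lineW L (TW (Fp L) a')) (realDiagonal_lineW L (TW (Fp L) a')) (diagonal_lineW L (TW (Fp L) a') (JW_eq (Fp L) L a')) (undoubledSplittings L e₁ dV hdV hdV0 (lineW L (TW (Fp L) a')) (complexConj_lineW L (TW (Fp L) a')) (lineW_ne_zero L (TW (Fp L) a') (isUnit_det_TW (Fp L) a')) (toHeckeCharacter L lam') (borelPlaceMeasure L) (cmFinLocalFamily L e₁ dV hdV hdV0 (lineW L (TW (Fp L) a')) (complexConj_lineW L (TW (Fp L) a')) (lineW_ne_zero L (TW (Fp L) a') (isUnit_det_TW (Fp L) a')) (toHeckeCharacter L lam') ((isOscillatorChar_toHeckeCharacter_iff lam').mpr hlam') (borelPlaceMeasure L))) (isSymm_TW (Fp L) a') (JW_eq (Fp L) L a')).omegaLoc v).comp (localCenter L (IsCMField.complexConj L) n' (Matrix.reindex e₁ e₁ (Matrix.diagonal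 dV ⊗ₖ JW (Fp L) L a')) (JW (Fp L) L a')
              (JW_apply_ne_zero (Fp L) L a') v)) χ') ↔ χ' ≠ χ₀)) ∧
      (∃ χ' : localPi L (IsCMField.complexConj L) 1 (JW (Fp L) L a') v →* ℂˣ, (∀ x : (LocalRing L v)ˣ, χ' ((LemD1OfPlace.theta L v (IsCMField.complexConj L) 2 (Matrix.diagonal dV) (complexConj_imagUnit L) (imagUnit_ne_zero L) (le_refl 2) (transpose_map_conj_JV (Fp L) L (IsCMField.complexConj L) 2 (Matrix.diagonal dV) (realDiagonal_isSymm L dV hdV) (realDiagonal_map L dV hdV).symm) (det_JV_ne_zero (Fp L) L 2 (Matrix.diagonal dV) (isUnit_det_realDiagonal L dV hdV hdV0) (realDiagonal_map L dV hdV).symm) (JW (Fp L) L a')) ((LemD1OfPlace.standingData L v (IsCMField.complexConj L) 2 (Matrix.diagonal dV) (complexConj_imagUnit L) (imagUnit_ne_zero L) (le_refl 2) (transpose_map_conj_JV (Fp L) L (IsCMField.complexConj L) 2 (Matrix.diagonal dV) (realDiagonal_isSymm L dV hdV) (realDiagonal_map L dV hdV).symm) (det_JV_ne_zero (Fp L)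 L 2 (Matrix.diagonal dV) (isUnit_det_realDiagonal L dV hdV hdV0) (realDiagonal_map L dV hdV).symm)).divConj x)) = localMu L (toHeckeCharacter L lam') v x ^ 2) ∧
        Subsingleton (TwistedCoinv.Coinv (show Representation ℂ (localPi L (IsCMField.complexConj L) 1 (JW (Fp L) L a') v) (SchwartzBruhat (Fin n' → v.adicCompletion (Fp L))) from
            ((congrW L e₁ dV hdV (lineW L (TW (Fp L) a')) (complexConj_lineW L (TW (Fp L) a')) (realDiagonal_lineW L (TW (Fp L) a')) (diagonal_lineW L (TW (Fp L) a') (JW_eq (Fp L) L a')) (undoubledSplittings L e₁ dV hdV hdV0 (lineW L (TW (Fp L) a')) (complexConj_lineW L (TW (Fp L) a')) (lineW_ne_zero L (TW (Fp L) a') (isUnit_det_TW (Fp L) a')) (toHeckeCharacter L lam') (borelPlaceMeasure L) (cmFinLocalFamily L e₁ dV hdV hdV0 (lineW L (TW (Fp L) a')) (complexConj_lineW L (TW (Fp L) a')) (lineW_ne_zero L (TW (Fp L) a') (isUnit_det_TW (Fp L) a')) (toHeckeCharacter L lam') ((isOscillatorChar_toHeckeCharacter_iff lam').mpr hlam') (borelPlaceMeasure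 L))) (isSymm_TW (Fp L) a') (JW_eq (Fp L) L a')).omegaLoc v).comp (localCenter L (IsCMField.complexConj L) n' (Matrix.reindex e₁ e₁ (Matrix.diagonal dV ⊗ₖ JW (Fp L) L a')) (JW (Fp L) L a')
              (JW_apply_ne_zero (Fp L) L a') v)) χ'))) :
    LemD1_1AsPrintedNonsplitCM₂ :=
  lemD1_1AsPrintedNonsplitCM₂_of_forall_isAnisotropic fun L _ _ _ dV hdV hdV0 _ e₁ χ a' lam' hlam' v hv han =>
    lemD1_1AsPrinted_localLemD1DataAtV₂_cm_of_forall_smul_eq_of_isAnisotropic_of_pinnedDichotomy L dV hdV hdV0 e₁ χ a' lam' hlam' v hv han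
      (h L dV hdV hdV0 e₁ χ a' lam' hlam' v hv han).1 (h L dV hdV hdV0 e₁ χ a' lam' hlam' v hv han).2

set_option maxHeartbeats 800000 in
/-- **… hence the ALL-PLACES letter ★ `LemD1_1AsPrintedCM₂`** (the split places are ★ `LemD1_1AsPrintedNonsplitCM₂.toAllPlaces`).
[cite: Liu2021, App. D Lemma D.1 (1) (p. 125, l. 5226–5229); proof l. 5241–5245 (p. 126)] [cite: HarrisKudlaSweet1996, Prop. 5.1 (iii)]
[cite: MoeglinVignerasWaldspurger1987, Chap. 3 IV.2; IV.4] -/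
theorem lemD1_1AsPrintedCM₂_of_forall_pinnedDichotomy
    (h : ∀ (L : Type) [Field L] [NumberField L] [IsCMField L]
      (dV : Fin 2 → L) (hdV : ∀ i, IsCMField.complexConj L (dV i) = dV i) (hdV0 : ∀ i, dV i ≠ 0)
      {n' : ℕ} (e₁ : Fin 2 × Fin 1 ≃ Fin n')
      (χ : Chi (↥(maximalRealSubfield L)) L (IsCMField.complexConj L)) (a' : (↥(maximalRealSubfield L))ˣ)
      (lam' : Literature.NumberTheory.Automorphic.IdeleClassGroup L →ₜ* Circle) (hlam' : IsConjugateSymplectic L lam')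
      (v : HeightOneSpectrum (𝓞 ↥(maximalRealSubfield L))),
      (∀ w : UnitaryGroup.PlacesOver L v, IsCMField.complexConj L • (w : HeightOneSpectrum (𝓞 L)) = w) →
      (localLemD1DataAtV₂ (Fp L) L (IsCMField.complexConj L) 2 e₁ (Matrix.diagonal dV) (complexConj_imagUnit L)
        (imagUnit_ne_zero L) (imagUnit_mul_self L) (realDiagonal_isSymm L dV hdV) (isUnit_det_realDiagonal L dV hdV hdV0)
        (realDiagonal_map L dV hdV).symm a' (congrW L e₁ dV hdV (lineW L (TW (Fp L) a')) (complexConj_lineW L (TW (Fp L) a')) (realDiagonal_lineW L (TW (Fp L) a')) (diagonal_lineW L (TW (Fp L) a') (JW_eq (Fp L) L a')) (undoubledSplittings L e₁ dV hdV hdV0 (lineW L (TW (Fp L) a')) (complexConj_lineW L (TW (Fp L) a')) (lineW_ne_zero L (TW (Fp L) a') (isUnit_det_TW (Fp L) a')) (toHeckeCharacter L lam') (borelPlaceMeasure L) (cmFinLocalFamily L e₁ dV hdV hdV0 (lineW L (TW (Fp L) a')) (complexConj_lineW L (TW (Fp L) a')) (lineW_ne_zero L (TW (Fp L) a') (isUnit_det_TW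 (Fp L) a')) (toHeckeCharacter L lam') ((isOscillatorChar_toHeckeCharacter_iff lam').mpr hlam') (borelPlaceMeasure L))) (isSymm_TW (Fp L) a') (JW_eq (Fp L) L a')) (by -- `2 ≤ n'` (§D.1 «rank n ≥ 2»); the assembler's proof argument here is `two_le_of_finTwo_equiv e₁`
          have h := Fintype.card_congr e₁
          simp only [Fintype.card_prod, Fintype.card_fin, mul_one] at h
          omega)
        (localMu L (toHeckeCharacter L lam')) (fun v x => norm_localMu L (toHeckeCharacter L lam') v (isUnitary_toHeckeCharacter L lam') x)
        (continuous_localMu L (toHeckeCharacter L lam'))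
        (fun v t => localMu_toLocalRing_eq_one_iff L (toHeckeCharacter L lam') v ((isOscillatorChar_toHeckeCharacter_iff lam').mpr hlam') t)
        χ v).IsAnisotropic →
      (∃ χ₀ : localPi L (IsCMField.complexConj L) 1 (JW (Fp L) L a') v →* ℂˣ, IsOpen (χ₀.ker : Set (localPi L (IsCMField.complexConj L) 1 (JW (Fp L) L a') v)) ∧
        ∀ χ' : localPi L (IsCMField.complexConj L) 1 (JW (Fp L) L a') v →* ℂˣ, (∀ u, ‖((χ' u : ℂˣ) : ℂ)‖ = 1) → (Continuous fun u => ((χ' u : ℂˣ) : ℂ)) →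
          (Nontrivial (TwistedCoinv.Coinv (show Representation ℂ (localPi L (IsCMField.complexConj L) 1 (JW (Fp L) L a') v) (SchwartzBruhat (Fin n' → v.adicCompletion (Fp L))) from
            ((congrW L e₁ dV hdV (lineW L (TW (Fp L) a')) (complexConj_lineW L (TW (Fp L) a')) (realDiagonal_lineW L (TW (Fp L) a')) (diagonal_lineW L (TW (Fp L) a') (JW_eq (Fp L) L a')) (undoubledSplittings L e₁ dV hdV hdV0 (lineW L (TW (Fp L) a')) (complexConj_lineW L (TW (Fp L) a')) (lineW_ne_zero L (TW (Fp L) a') (isUnit_det_TW (Fp L) a')) (toHeckeCharacter L lam') (borelPlaceMeasure L) (cmFinLocalFamily L e₁ dV hdV hdV0 (lineW L (TW (Fp L) a')) (complexConj_lineW L (TW (Fp L) a')) (lineW_ne_zero L (TW (Fp L) a') (isUnit_det_TW (Fp L) a')) (toHeckeCharacter L lam') ((isOscillatorChar_toHeckeCharacter_iff lam').mpr hlam') (borelPlaceMeasure L))) (isSymm_TW (Fp L) a') (JW_eq (Fp L) L a')).omegaLoc v).comp (localCenter L (IsCMField.complexConj L) n' (Matrix.reindex e₁ e₁ (Matrix.diagonal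 dV ⊗ₖ JW (Fp L) L a')) (JW (Fp L) L a')
              (JW_apply_ne_zero (Fp L) L a') v)) χ') ↔ χ' ≠ χ₀)) ∧
      (∃ χ' : localPi L (IsCMField.complexConj L) 1 (JW (Fp L) L a') v →* ℂˣ, (∀ x : (LocalRing L v)ˣ, χ' ((LemD1OfPlace.theta L v (IsCMField.complexConj L) 2 (Matrix.diagonal dV) (complexConj_imagUnit L) (imagUnit_ne_zero L) (le_refl 2) (transpose_map_conj_JV (Fp L) L (IsCMField.complexConj L) 2 (Matrix.diagonal dV) (realDiagonal_isSymm L dV hdV) (realDiagonal_map L dV hdV).symm) (det_JV_ne_zero (Fp L) L 2 (Matrix.diagonal dV) (isUnit_det_realDiagonal L dV hdV hdV0) (realDiagonal_map L dV hdV).symm) (JW (Fp L) L a')) ((LemD1OfPlace.standingData L v (IsCMField.complexConj L) 2 (Matrix.diagonal dV) (complexConj_imagUnit L) (imagUnit_ne_zero L) (le_refl 2) (transpose_map_conj_JV (Fp L) L (IsCMField.complexConj L) 2 (Matrix.diagonal dV) (realDiagonal_isSymm L dV hdV) (realDiagonal_map L dV hdV).symm) (det_JV_ne_zero (Fp L)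 L 2 (Matrix.diagonal dV) (isUnit_det_realDiagonal L dV hdV hdV0) (realDiagonal_map L dV hdV).symm)).divConj x)) = localMu L (toHeckeCharacter L lam') v x ^ 2) ∧
        Subsingleton (TwistedCoinv.Coinv (show Representation ℂ (localPi L (IsCMField.complexConj L) 1 (JW (Fp L) L a') v) (SchwartzBruhat (Fin n' → v.adicCompletion (Fp L))) from
            ((congrW L e₁ dV hdV (lineW L (TW (Fp L) a')) (complexConj_lineW L (TW (Fp L) a')) (realDiagonal_lineW L (TW (Fp L) a')) (diagonal_lineW L (TW (Fp L) a') (JW_eq (Fp L) L a')) (undoubledSplittings L e₁ dV hdV hdV0 (lineW L (TW (Fp L) a')) (complexConj_lineW L (TW (Fp L) a')) (lineW_ne_zero L (TW (Fp L) a') (isUnit_det_TW (Fp L) a')) (toHeckeCharacter L lam') (borelPlaceMeasure L) (cmFinLocalFamily L e₁ dV hdV hdV0 (lineW L (TW (Fp L) a')) (complexConj_lineW L (TW (Fp L) a')) (lineW_ne_zero L (TW (Fp L) a') (isUnit_det_TW (Fp L) a')) (toHeckeCharacter L lam') ((isOscillatorChar_toHeckeCharacter_iff lam').mpr hlam') (borelPlaceMeasure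 L))) (isSymm_TW (Fp L) a') (JW_eq (Fp L) L a')).omegaLoc v).comp (localCenter L (IsCMField.complexConj L) n' (Matrix.reindex e₁ e₁ (Matrix.diagonal dV ⊗ₖ JW (Fp L) L a')) (JW (Fp L) L a')
              (JW_apply_ne_zero (Fp L) L a') v)) χ'))) :
    LemD1_1AsPrintedCM₂ :=
  (lemD1_1AsPrintedNonsplitCM₂_of_forall_pinnedDichotomy h).toAllPlaces

end Literature.NumberTheory.Automorphic.Liu2021.LemD1RankTwoCMLetters

end
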